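import Literature.Analysis.FluidPDE.PassiveVectorTensorGalerkinSmooth
import Literature.Analysis.FluidPDE.PassiveVectorGalerkinEnstrophyTools
import Literature.Analysis.FluidPDE.PassiveVectorTensorDissipationDensity
import Literature.Analysis.FluidPDE.PassiveVectorTensorDuality
import HarnessLib

/-!
# The Fourier–Galerkin scheme with a smooth carrier, II: energy bookkeeping, ENSTROPHY Grönwall bound and the
  loss-rate monotonicity of the Galerkin approximations

Analysis/FluidPDE proof-support file (everything proved; no definitions, no named facts). Sequel of
`PassiveVectorTensorGalerkinSmooth`; the estimates of the tenure ruling D26-17′ (cell `ad-ideate`, K1L_D), certifier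
(S2′): along a solution `α` of `α' = pvsRHS S 𝔸 (b t) α` with `NearIso 𝔸 lo hi` and a smooth carrier
`SmoothCarrier b M G`, writing `E(t) = Σ_k ‖α t k‖²` (energy), `Z(t) = 4π² Σ_k |k|²‖α t k‖²` (enstrophy) and
`D(t) = 4π² Σ_k Re⟪α t k, T_𝔸(k) α t k⟫` (dissipation rate):

* `pvsEnergy_eq_sub_integral` — the integrated energy identity `E(t₂) = E(t₁) − 2∫_{t₁}^{t₂} D`;
* `lo_mul_pvsEnstrophy_le_pvsDiss`, `pvsDiss_le_abs_hi_mul_pvsEnstrophy` — the sandwich `lo·Z ≤ D ≤ |hi|·Z`;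
* `pvsEnstrophy_deriv_le`, `pvsEnstrophy_le_exp_mul` — `Z' ≤ 2·(card d)·G·Z`, hence
  `Z(t₂) ≤ exp(2·(card d)·G·(t₂−t₁))·Z(t₁)` (no condition on the odd part of `𝔸`: the anti-Hermitian part of
  `T_𝔸(k)` drops under the scalar weight `|k|²`; the transport part `(b·∇)∂_j` integrates to zero);
* `pvsDiss_le_mul_pvsDiss` — quasi-monotonicity of the rate: `D(t₂) ≤ (|hi|/lo)·exp(2·card·G·(t₂−t₁))·D(t₁)`;
* the real-variable averaging lemma (private); and the **loss-rate monotonicity at the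
  Galerkin level** `pvsEnergy_loss_later_le`:
  `E(ρ) − E(θ) ≤ ((|hi|/lo)·exp(2·card·G·θ)) · ((θ − ρ)/ρ) · (E(0) − E(ρ))` for `0 < ρ ≤ θ`;
* `sum_re_inner_symbT_le_pvsDiss` — every truncated symbol form is below the full rate (termwise nonnegativity), and
  `re_inner_symbT_majorTranspose_self` (`Re⟪z, T_{𝔸ᵀ} z⟫ = Re⟪z, T_𝔸 z⟫`).

## References

* J. C. Robinson, J. L. Rodrigo, W. Sadowski, *The three-dimensional Navier–Stokes equations* (CUP 2016), Thm. 4.4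
  Step 2, §6.1. [`RobinsonRodrigoSadowski2016`]
* P. Constantin, C. Foias, *Navier–Stokes Equations* (Chicago 1988), Ch. 8 (8.3)–(8.9), Ch. 9. [`ConstantinFoias1988`]
* U. Frisch, *Turbulence* (CUP 1995), §9.6.3 eq. (9.57). [`Frisch1995Turbulence`]
-/

open MeasureTheory Set Filter Topology UnitAddTorus
open scoped ENNReal NNReal InnerProductSpace

noncomputable section

namespace Literature.Analysis.FluidPDE

open FunctionSpaces.Torus FunctionSpaces Torus

variable {d : Type*} [Fintype d] [DecidableEq d] {S : Finset (d → ℤ)}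

/-! ## The three quadratic quantities of a coefficient vector -/

variable (S) in
/-- The coefficient energy `E(c) = Σ_k ‖c k‖²`. [cite: RobinsonRodrigoSadowski2016, Thm. 4.4 Step 2 (4.8)] -/
def pvsEnergy (c : ↥S → EuclideanSpace ℂ d) : ℝ := ∑ k, ‖c k‖ ^ 2

variable (S) in
/-- The coefficient enstrophy `Z(c) = 4π² Σ_k |k|² ‖c k‖²` (`= ‖∇ realTrigPoly S c̄‖²`). [cite: RobinsonRodrigoSadowski2016, Thm. 4.4 Step 2 (4.8)] -/
def pvsEnstrophy (c : ↥S → EuclideanSpace ℂ d) : ℝ := ∑ k : ↥S, 4 * Real.pi ^ 2 * freqNormSq (k : d → ℤ) * ‖c k‖ ^ 2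

variable (S) in
/-- The dissipation rate `D(c) = 4π² Σ_k Re⟪c k, T_𝔸(k) c k⟫` of the tensor `𝔸`. [cite: Frisch1995Turbulence, §9.6.3 eq. (9.57) p. 233] -/
def pvsDiss (𝔸 : Visc4 d) (c : ↥S → EuclideanSpace ℂ d) : ℝ :=
  4 * Real.pi ^ 2 * ∑ k : ↥S, (inner ℂ (c k) (symbT 𝔸 k (c k))).re

omit [DecidableEq d] in
/-- `E ≥ 0`. [cite: RobinsonRodrigoSadowski2016, Thm. 4.4 Step 2 (4.8)] -/
theorem pvsEnergy_nonneg (c : ↥S → EuclideanSpace ℂ d) : 0 ≤ pvsEnergy S c :=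
  Finset.sum_nonneg fun _ _ => sq_nonneg _

omit [DecidableEq d] in
/-- `Z ≥ 0`. [cite: RobinsonRodrigoSadowski2016, Thm. 4.4 Step 2 (4.8)] -/
theorem pvsEnstrophy_nonneg (c : ↥S → EuclideanSpace ℂ d) : 0 ≤ pvsEnstrophy S c :=
  Finset.sum_nonneg fun k _ => by have := freqNormSq_nonneg (k : d → ℤ); positivity

omit [DecidableEq d] in
/-- The dissipation rate as a sum over `k ∈ S` of the extended family. [cite: Frisch1995Turbulence, §9.6.3 eq. (9.57) p. 233] -/
theorem pvsDiss_eq_sum_coeffExt (𝔸 : Visc4 d) (c : ↥S → EuclideanSpace ℂ d) :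
    pvsDiss S 𝔸 c = 4 * Real.pi ^ 2 * ∑ k ∈ S, (inner ℂ (coeffExt S c k) (symbT 𝔸 k (coeffExt S c k))).re := by
  rw [pvsDiss, ← sum_coeffExt (fun k v => (inner ℂ v (symbT 𝔸 k v)).re) c]

omit [DecidableEq d] in
/-- The enstrophy as a sum over `k ∈ S` of the extended family. [cite: RobinsonRodrigoSadowski2016, Thm. 4.4 Step 2 (4.8)] -/
theorem pvsEnstrophy_eq_sum_coeffExt (c : ↥S → EuclideanSpace ℂ d) :
    pvsEnstrophy S c = 4 * Real.pi ^ 2 * ∑ k ∈ S, freqNormSq k * ‖coeffExt S c k‖ ^ 2 := by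
  rw [pvsEnstrophy, ← sum_coeffExt (fun k v => 4 * Real.pi ^ 2 * freqNormSq k * ‖v‖ ^ 2) c, Finset.mul_sum]
  exact Finset.sum_congr rfl fun k _ => by ring

/-! ## The sandwich `lo·Z ≤ D ≤ |hi|·Z` on transversal states -/

omit [DecidableEq d] in
/-- **Lower Legendre–Hadamard window**: `lo·Z(c) ≤ D(c)` for transversal `c` and `NearIso 𝔸 lo hi`. [cite: Frisch1995Turbulence, §9.6.3 eq. (9.57) p. 233] -/
theorem lo_mul_pvsEnstrophy_le_pvsDiss {𝔸 : Visc4 d} {lo hi : ℝ} (h𝔸 : NearIso 𝔸 lo hi) {c : ↥S → EuclideanSpace ℂ d}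
    (hc : IsSolenoidalCoeff c) : lo * pvsEnstrophy S c ≤ pvsDiss S 𝔸 c := by
  rw [pvsEnstrophy, pvsDiss, Finset.mul_sum, Finset.mul_sum]
  refine Finset.sum_le_sum fun k _ => ?_
  have h := lo_mul_le_re_inner_symbT h𝔸 (hc k)
  have h4 : (0:ℝ) ≤ 4 * Real.pi ^ 2 := by positivity
  nlinarith [h, h4]

omit [DecidableEq d] in
/-- **Upper Legendre–Hadamard window**: `D(c) ≤ |hi|·Z(c)` for transversal `c` and `NearIso 𝔸 lo hi`. [cite: Frisch1995Turbulence, §9.6.3 eq. (9.57) p. 233] -/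
theorem pvsDiss_le_abs_hi_mul_pvsEnstrophy {𝔸 : Visc4 d} {lo hi : ℝ} (h𝔸 : NearIso 𝔸 lo hi) {c : ↥S → EuclideanSpace ℂ d}
    (hc : IsSolenoidalCoeff c) : pvsDiss S 𝔸 c ≤ |hi| * pvsEnstrophy S c := by
  rw [pvsEnstrophy, pvsDiss, Finset.mul_sum, Finset.mul_sum]
  refine Finset.sum_le_sum fun k _ => ?_
  have h := IsWeakTensorPassiveVectorOn.re_inner_symbT_le_abs_hi_mul h𝔸 (hc k)
  have h4 : (0:ℝ) ≤ 4 * Real.pi ^ 2 := by positivity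
  nlinarith [h, h4]

omit [DecidableEq d] in
/-- `D(c) ≥ 0` on transversal states for `0 ≤ lo`. [cite: Frisch1995Turbulence, §9.6.3 eq. (9.57) p. 233] -/
theorem pvsDiss_nonneg {𝔸 : Visc4 d} {lo hi : ℝ} (h𝔸 : NearIso 𝔸 lo hi) (hlo : 0 ≤ lo) {c : ↥S → EuclideanSpace ℂ d}
    (hc : IsSolenoidalCoeff c) : 0 ≤ pvsDiss S 𝔸 c :=
  (mul_nonneg hlo (pvsEnstrophy_nonneg c)).trans (lo_mul_pvsEnstrophy_le_pvsDiss h𝔸 hc)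

omit [DecidableEq d] in
/-- **Every truncated symbol form is below the full rate**: for a finite `F ⊆ ℤ^d` and a transversal state,
`4π² Σ_{k∈F} Re⟪c̄ k, T c̄ k⟫ ≤ D(c)` (termwise nonnegativity on transversal vectors, `0 ≤ lo`). [cite: Frisch1995Turbulence, §9.6.3 eq. (9.57) p. 233] -/
theorem sum_re_inner_symbT_le_pvsDiss {𝔸 : Visc4 d} {lo hi : ℝ} (h𝔸 : NearIso 𝔸 lo hi) (hlo : 0 ≤ lo)
    {c : ↥S → EuclideanSpace ℂ d} (hc : IsSolenoidalCoeff c) (F : Finset (d → ℤ)) :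
    4 * Real.pi ^ 2 * ∑ k ∈ F, (inner ℂ (coeffExt S c k) (symbT 𝔸 k (coeffExt S c k))).re ≤ pvsDiss S 𝔸 c := by
  classical
  rw [pvsDiss_eq_sum_coeffExt]
  refine mul_le_mul_of_nonneg_left ?_ (by positivity)
  have hT : IsTransversal S (coeffExt S c) := hc.isTransversal_coeffExt
  have hnn : ∀ k, 0 ≤ (inner ℂ (coeffExt S c k) (symbT 𝔸 k (coeffExt S c k))).re := by
    intro k
    by_cases hk : k ∈ S
    · refine le_trans ?_ (lo_mul_le_re_inner_symbT h𝔸 (hT k hk))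
      have := freqNormSq_nonneg k
      positivity
    · rw [coeffExt_of_not_mem c hk]; simp
  have hsplit : ∑ k ∈ F, (inner ℂ (coeffExt S c k) (symbT 𝔸 k (coeffExt S c k))).re =
      ∑ k ∈ F ∩ S, (inner ℂ (coeffExt S c k) (symbT 𝔸 k (coeffExt S c k))).re := by
    refine (Finset.sum_subset Finset.inter_subset_left fun k hkF hk => ?_).symm
    have hkS : k ∉ S := fun hkS => hk (Finset.mem_inter.2 ⟨hkF, hkS⟩)
    rw [coeffExt_of_not_mem c hkS]; simp
  rw [hsplit]
  exact Finset.sum_le_sum_of_subset_of_nonneg Finset.inter_subset_right fun k _ _ => hnn k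

omit [DecidableEq d] in
/-- The quadratic form of `T_{𝔸ᵀ}` has the same real part as that of `T_𝔸`: `Re⟪z, T_{𝔸ᵀ}(k) z⟫ = Re⟪z, T_𝔸(k) z⟫`.
[cite: Frisch1995Turbulence, §9.6.3 eq. (9.57) p. 233] -/
theorem re_inner_symbT_majorTranspose_self (𝔸 : Visc4 d) (k : d → ℤ) (z : EuclideanSpace ℂ d) :
    (inner ℂ z (symbT (majorTranspose 𝔸) k z)).re = (inner ℂ z (symbT 𝔸 k z)).re := by
  rw [← inner_conj_symm, Complex.conj_re, inner_symbT_majorTranspose_left]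

omit [DecidableEq d] in
/-- `D_{𝔸ᵀ}(c) = D_𝔸(c)`. [cite: Frisch1995Turbulence, §9.6.3 eq. (9.57) p. 233] -/
theorem pvsDiss_majorTranspose (𝔸 : Visc4 d) (c : ↥S → EuclideanSpace ℂ d) :
    pvsDiss S (majorTranspose 𝔸) c = pvsDiss S 𝔸 c := by
  unfold pvsDiss
  simp_rw [re_inner_symbT_majorTranspose_self]

/-! ## The energy identity in integrated form -/

/-- The derivative of the energy along a solution is `−2 D`. [cite: RobinsonRodrigoSadowski2016, Thm. 4.4 Step 2 (4.6)–(4.7)] -/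
theorem hasDerivWithinAt_pvsEnergy_eq (𝔸 : Visc4 d) (hS : ∀ k ∈ S, -k ∈ S) {b : UnitAddTorus d → EuclideanSpace ℝ d}
    (hb : IsSmooth b) (hbdiv : IsDivFree b) {α : ℝ → ↥S → EuclideanSpace ℂ d} {s : Set ℝ} {t : ℝ}
    (h : HasDerivWithinAt α (pvsRHS S 𝔸 b (α t)) s t) (hmem : α t ∈ galerkinSubspace S) :
    HasDerivWithinAt (fun τ => pvsEnergy S (α τ)) (-(2 * pvsDiss S 𝔸 (α t))) s t := by
  have h1 := hasDerivWithinAt_pvsEnergy 𝔸 h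
  rw [sum_re_inner_pvsField_self_eq 𝔸 hS hb hbdiv (hmem.1.isConjSymm_coeffExt hS) hmem.2.isTransversal_coeffExt,
    ← pvsDiss_eq_sum_coeffExt] at h1
  have e : (2 : ℝ) * -pvsDiss S 𝔸 (α t) = -(2 * pvsDiss S 𝔸 (α t)) := by ring
  rw [e] at h1
  exact h1

omit [DecidableEq d] in
/-- The dissipation rate is continuous along a continuous state curve. [cite: RobinsonRodrigoSadowski2016, Thm. 4.4 Step 2 (4.6)] -/
theorem continuousOn_pvsDiss_comp (𝔸 : Visc4 d) {α : ℝ → ↥S → EuclideanSpace ℂ d} {s : Set ℝ} (hα : ContinuousOn α s) :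
    ContinuousOn (fun t => pvsDiss S 𝔸 (α t)) s := by
  unfold pvsDiss
  refine continuousOn_const.mul (continuousOn_finsetSum _ fun k _ => ?_)
  have hk : ContinuousOn (fun t => α t k) s := (continuous_apply k).comp_continuousOn hα
  have hT : ContinuousOn (fun t => symbT 𝔸 k (α t k)) s :=
    ((symbTL 𝔸 (k : d → ℤ)).continuous.comp_continuousOn hk).congr fun _ _ => rfl
  exact Complex.continuous_re.comp_continuousOn (hk.inner hT)

/-- **The energy identity in integrated form**: along a solution on `[0, T]` staying in the Galerkin phase space,
`E(t₂) = E(t₁) − 2 ∫_{t₁}^{t₂} D` for `0 ≤ t₁ ≤ t₂ ≤ T`. [cite: RobinsonRodrigoSadowski2016, Thm. 4.4 Step 2 (4.8)] -/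
theorem pvsEnergy_eq_sub_integral (𝔸 : Visc4 d) (hS : ∀ k ∈ S, -k ∈ S) {b : ℝ → UnitAddTorus d → EuclideanSpace ℝ d}
    (hb : ∀ t, IsSmooth (b t)) (hbdiv : ∀ t, IsDivFree (b t)) {T : ℝ} {α : ℝ → ↥S → EuclideanSpace ℂ d}
    (hα : ∀ t ∈ Icc 0 T, HasDerivWithinAt α (pvsRHS S 𝔸 (b t) (α t)) (Icc 0 T) t)
    (hmem : ∀ t ∈ Icc 0 T, α t ∈ galerkinSubspace S) (hcont : ContinuousOn α (Icc 0 T))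
    {t₁ t₂ : ℝ} (h1 : 0 ≤ t₁) (h12 : t₁ ≤ t₂) (h2 : t₂ ≤ T) :
    pvsEnergy S (α t₂) = pvsEnergy S (α t₁) - 2 * ∫ τ in t₁..t₂, pvsDiss S 𝔸 (α τ) := by
  have hsub : Icc t₁ t₂ ⊆ Icc 0 T := Icc_subset_Icc h1 h2
  have hderiv : ∀ τ ∈ Icc t₁ t₂, HasDerivWithinAt (fun τ => pvsEnergy S (α τ)) (-(2 * pvsDiss S 𝔸 (α τ))) (Icc t₁ t₂) τ :=
    fun τ hτ => (hasDerivWithinAt_pvsEnergy_eq 𝔸 hS (hb τ) (hbdiv τ) (hα τ (hsub hτ)) (hmem τ (hsub hτ))).mono hsub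
  have hEcont : ContinuousOn (fun τ => pvsEnergy S (α τ)) (Icc t₁ t₂) := fun τ hτ => (hderiv τ hτ).continuousWithinAt
  have hDcont : ContinuousOn (fun τ => -(2 * pvsDiss S 𝔸 (α τ))) (Icc t₁ t₂) :=
    (continuousOn_const.mul ((continuousOn_pvsDiss_comp 𝔸 hcont).mono hsub)).neg
  have hFTC := intervalIntegral.integral_eq_sub_of_hasDeriv_right_of_le h12 hEcont
    (fun τ hτ => (hderiv τ (Ioo_subset_Icc_self hτ)).mono_of_mem_nhdsWithin
      (mem_nhdsWithin.2 ⟨Iio t₂, isOpen_Iio, hτ.2, fun z hz => ⟨(hτ.1.trans hz.2).le, le_of_lt hz.1⟩⟩))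
    (hDcont.intervalIntegrable_of_Icc h12)
  have hint : ∫ τ in t₁..t₂, -(2 * pvsDiss S 𝔸 (α τ)) = -(2 * ∫ τ in t₁..t₂, pvsDiss S 𝔸 (α τ)) := by
    rw [intervalIntegral.integral_neg, intervalIntegral.integral_const_mul]
  rw [hint] at hFTC
  linarith

/-! ## The enstrophy Grönwall bound -/

/-- **The enstrophy balance**: for `NearIso 𝔸 lo hi`, `lo ≥ 0`, a real transversal state and a smooth divergence-free
carrier with `|∂_j b_a| ≤ G`, `Σ_k 4π²|k|² · 2Re⟪c k, V k⟫ ≤ 2·(card d)·G · Z(c)`. [cite: RobinsonRodrigoSadowski2016, §6.1] [cite: ConstantinFoias1988, Ch. 9] -/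
theorem pvsEnstrophy_deriv_le {𝔸 : Visc4 d} {lo hi : ℝ} (h𝔸 : NearIso 𝔸 lo hi) (hlo : 0 ≤ lo)
    (hS : ∀ k ∈ S, -k ∈ S) {c : ↥S → EuclideanSpace ℂ d} (hc : c ∈ galerkinSubspace S)
    {b : UnitAddTorus d → EuclideanSpace ℝ d} (hb : IsSmooth b) (hbdiv : IsDivFree b) {G : ℝ} (hG0 : 0 ≤ G)
    (hG : ∀ x j a, |FunctionSpaces.Torus.partialDeriv j b x a| ≤ G) :
    ∑ k : ↥S, 4 * Real.pi ^ 2 * freqNormSq (k : d → ℤ) * (2 * (inner ℂ (c k) (pvsRHS S 𝔸 b c k)).re) ≤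
      2 * ((Fintype.card d : ℝ) * G) * pvsEnstrophy S c := by
  have hcs : IsConjSymm (coeffExt S c) := hc.1.isConjSymm_coeffExt hS
  have hcT : IsTransversal S (coeffExt S c) := hc.2.isTransversal_coeffExt
  have hus : IsSmooth (realTrigPoly S (coeffExt S c)) := isSmooth_realTrigPoly S _
  -- pass to sums over `k ∈ S` of the extended family
  have eL : ∑ k : ↥S, 4 * Real.pi ^ 2 * freqNormSq (k : d → ℤ) * (2 * (inner ℂ (c k) (pvsRHS S 𝔸 b c k)).re) =
      2 * ∑ k ∈ S, 4 * Real.pi ^ 2 * freqNormSq k *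
        (inner ℂ (coeffExt S c k) (pvsField 𝔸 S b (coeffExt S c) k)).re := by
    simp_rw [pvsRHS_apply]
    rw [← sum_coeffExt (fun k v => 4 * Real.pi ^ 2 * freqNormSq k *
      (2 * (inner ℂ v (pvsField 𝔸 S b (coeffExt S c) k)).re)) c, Finset.mul_sum]
    exact Finset.sum_congr rfl fun k _ => by ring
  rw [eL, pvsEnstrophy_eq_sum_coeffExt]
  -- split the field
  have hsplit : ∀ k ∈ S, 4 * Real.pi ^ 2 * freqNormSq k *
      (inner ℂ (coeffExt S c k) (pvsField 𝔸 S b (coeffExt S c) k)).re =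
      -(16 * Real.pi ^ 4 * (freqNormSq k *
        (inner ℂ (coeffExt S c k) (leraySym k (symbT 𝔸 k (coeffExt S c k)))).re)) -
        4 * Real.pi ^ 2 * freqNormSq k *
          (inner ℂ (coeffExt S c k) (pvsConvCoeff S b (coeffExt S c) k)).re := by
    intro k hk
    rw [pvsField_def, inner_sub_right, Complex.sub_re, inner_neg_right, Complex.neg_re, inner_smul_right,
      Complex.re_ofReal_mul, inner_leraySym_right_of_transversal _ (pvsConvCoeff S _ _ k) (hcT k hk)]
    ring
  rw [Finset.sum_congr rfl hsplit, Finset.sum_sub_distrib, Finset.sum_neg_distrib, ← Finset.mul_sum]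
  -- the viscous term has a sign
  have hvisc := (sum_freqNormSq_mul_re_inner_leraySym_symbT_nonneg (S := S) h𝔸 hlo hcT).2
  -- the drift term in physical space
  simp only [pvsConvCoeff_def]
  rw [sum_freqNormSq_mul_re_inner_eq hS hcs (hb.convect hus)]
  have hdrift := abs_sum_integral_inner_partialDeriv_convect_le hb hbdiv hus hG0 hG
  rw [gradNormSq_realTrigPoly hS hcs] at hdrift
  have h1 := neg_le_of_abs_le hdrift
  have hV : 0 ≤ 16 * Real.pi ^ 4 * ∑ k ∈ S, freqNormSq k *
      (inner ℂ (coeffExt S c k) (leraySym k (symbT 𝔸 k (coeffExt S c k)))).re :=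
    mul_nonneg (by positivity) hvisc
  nlinarith [hV, h1, hG0]

/-- **Enstrophy Grönwall bound.** Along a solution on `[0,s']` (`NearIso 𝔸 lo hi`, `lo ≥ 0`, smooth carrier with
`|∂_j (b t)_a| ≤ G`): `Z(t₂) ≤ exp(2·(card d)·G·(t₂ − t₁)) · Z(t₁)` for `0 ≤ t₁ ≤ t₂ ≤ s'`.
[cite: RobinsonRodrigoSadowski2016, §6.1] [cite: ConstantinFoias1988, Ch. 9] -/
theorem pvsEnstrophy_le_exp_mul {𝔸 : Visc4 d} {lo hi : ℝ} (h𝔸 : NearIso 𝔸 lo hi) (hlo : 0 ≤ lo)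
    (hS : ∀ k ∈ S, -k ∈ S) {b : ℝ → UnitAddTorus d → EuclideanSpace ℝ d} {M G : ℝ} (hb : SmoothCarrier b M G)
    {s' : ℝ} {α : ℝ → ↥S → EuclideanSpace ℂ d}
    (hα : ∀ t ∈ Icc 0 s', HasDerivWithinAt α (pvsRHS S 𝔸 (b t) (α t)) (Icc 0 s') t)
    (hmem : ∀ t ∈ Icc 0 s', α t ∈ galerkinSubspace S)
    {t₁ t₂ : ℝ} (h0 : 0 ≤ t₁) (h12 : t₁ ≤ t₂) (h2 : t₂ ≤ s') :
    pvsEnstrophy S (α t₂) ≤ Real.exp (2 * ((Fintype.card d : ℝ) * G) * (t₂ - t₁)) * pvsEnstrophy S (α t₁) := by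
  set Z : ℝ → ℝ := fun τ => pvsEnstrophy S (α τ) with hZ
  set Z' : ℝ → ℝ := fun τ => ∑ k : ↥S, 4 * Real.pi ^ 2 * freqNormSq (k : d → ℤ) *
    (2 * (inner ℂ (α τ k) (pvsRHS S 𝔸 (b τ) (α τ) k)).re) with hZ'
  have hsub : Icc t₁ t₂ ⊆ Icc 0 s' := Icc_subset_Icc h0 h2
  have hderiv : ∀ τ ∈ Icc t₁ t₂, HasDerivWithinAt Z (Z' τ) (Icc t₁ t₂) τ := fun τ hτ =>
    (hasDerivWithinAt_weighted_sum_norm_sq (fun k : ↥S => 4 * Real.pi ^ 2 * freqNormSq (k : d → ℤ))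
      (hα τ (hsub hτ))).mono hsub
  have hcont : ContinuousOn Z (Icc t₁ t₂) := fun τ hτ => (hderiv τ hτ).continuousWithinAt
  have hbound : ∀ τ ∈ Ico t₁ t₂, Z' τ ≤ 2 * ((Fintype.card d : ℝ) * G) * Z τ + 0 := by
    intro τ hτ
    rw [add_zero]
    exact pvsEnstrophy_deriv_le h𝔸 hlo hS (hmem τ (hsub (Ico_subset_Icc_self hτ))) (hb.smooth τ) (hb.divFree τ)
      hb.grad_nonneg (fun x j a => hb.grad_le τ x j a)
  have hgron := le_gronwallBound_of_liminf_deriv_right_le (f := Z) (f' := Z') (δ := Z t₁)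
    (K := 2 * ((Fintype.card d : ℝ) * G)) (ε := 0) (a := t₁) (b := t₂) hcont (fun τ hτ r hr => ?_) le_rfl
    hbound t₂ ⟨h12, le_rfl⟩
  · rw [gronwallBound_ε0] at hgron
    exact hgron.trans_eq (mul_comm _ _)
  · have hmem_nhds : Icc t₁ t₂ ∈ 𝓝[Ici τ] τ :=
      mem_nhdsWithin.2 ⟨Iio t₂, isOpen_Iio, hτ.2, fun z hz => ⟨hτ.1.trans hz.2, hz.1.le⟩⟩
    exact ((hderiv τ (Ico_subset_Icc_self hτ)).mono_of_mem_nhdsWithin hmem_nhds) |>.liminf_right_slope_le hr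

/-- **Quasi-monotonicity of the dissipation rate** (the (S2′) sandwich): for `0 < lo`,
`D(t₂) ≤ (|hi|/lo)·exp(2·(card d)·G·(t₂ − t₁))·D(t₁)`, `0 ≤ t₁ ≤ t₂ ≤ s'`. [cite: RobinsonRodrigoSadowski2016, §6.1] -/
theorem pvsDiss_le_mul_pvsDiss {𝔸 : Visc4 d} {lo hi : ℝ} (h𝔸 : NearIso 𝔸 lo hi) (hlo : 0 < lo)
    (hS : ∀ k ∈ S, -k ∈ S) {b : ℝ → UnitAddTorus d → EuclideanSpace ℝ d} {M G : ℝ} (hb : SmoothCarrier b M G)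
    {s' : ℝ} {α : ℝ → ↥S → EuclideanSpace ℂ d}
    (hα : ∀ t ∈ Icc 0 s', HasDerivWithinAt α (pvsRHS S 𝔸 (b t) (α t)) (Icc 0 s') t)
    (hmem : ∀ t ∈ Icc 0 s', α t ∈ galerkinSubspace S)
    {t₁ t₂ : ℝ} (h0 : 0 ≤ t₁) (h12 : t₁ ≤ t₂) (h2 : t₂ ≤ s') :
    pvsDiss S 𝔸 (α t₂) ≤ (|hi| / lo * Real.exp (2 * ((Fintype.card d : ℝ) * G) * (t₂ - t₁))) * pvsDiss S 𝔸 (α t₁) := by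
  have hZ := pvsEnstrophy_le_exp_mul h𝔸 hlo.le hS hb hα hmem h0 h12 h2
  have hup := pvsDiss_le_abs_hi_mul_pvsEnstrophy h𝔸 (hmem t₂ ⟨h0.trans h12, h2⟩).2
  have hlow := lo_mul_pvsEnstrophy_le_pvsDiss h𝔸 (hmem t₁ ⟨h0, h12.trans h2⟩).2
  have hE0 : 0 ≤ Real.exp (2 * ((Fintype.card d : ℝ) * G) * (t₂ - t₁)) := (Real.exp_pos _).le
  have h1 : pvsEnstrophy S (α t₁) ≤ pvsDiss S 𝔸 (α t₁) / lo := by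
    rw [le_div_iff₀ hlo]; linarith
  calc pvsDiss S 𝔸 (α t₂) ≤ |hi| * pvsEnstrophy S (α t₂) := hup
    _ ≤ |hi| * (Real.exp (2 * ((Fintype.card d : ℝ) * G) * (t₂ - t₁)) * pvsEnstrophy S (α t₁)) :=
        mul_le_mul_of_nonneg_left hZ (abs_nonneg _)
    _ ≤ |hi| * (Real.exp (2 * ((Fintype.card d : ℝ) * G) * (t₂ - t₁)) * (pvsDiss S 𝔸 (α t₁) / lo)) :=
        mul_le_mul_of_nonneg_left (mul_le_mul_of_nonneg_left h1 hE0) (abs_nonneg _)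
    _ = (|hi| / lo * Real.exp (2 * ((Fintype.card d : ℝ) * G) * (t₂ - t₁))) * pvsDiss S 𝔸 (α t₁) := by
        field_simp

/-! ## The averaging lemma and the loss-rate monotonicity -/

omit [Fintype d] [DecidableEq d] in
/-- **Averaging lemma**: if `f` is continuous on `[0, θ]` and `f(τ₂) ≤ K f(τ₁)` whenever `0 ≤ τ₁ ≤ τ₂ ≤ θ` (`K > 0`),
then `∫_ρ^θ f ≤ K · ((θ − ρ)/ρ) · ∫_0^ρ f` for `0 < ρ ≤ θ` (each later value is at most `K` times the average over
`[0, ρ]`). [folklore] -/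
private theorem integral_later_le_of_quasiMonotone' {f : ℝ → ℝ} {θ ρ K : ℝ} (hK : 0 < K) (hρ : 0 < ρ) (hρθ : ρ ≤ θ)
    (hf : ContinuousOn f (Icc 0 θ)) (hmono : ∀ τ₁ τ₂, 0 ≤ τ₁ → τ₁ ≤ τ₂ → τ₂ ≤ θ → f τ₂ ≤ K * f τ₁) :
    ∫ τ in ρ..θ, f τ ≤ K * ((θ - ρ) / ρ) * ∫ τ in (0:ℝ)..ρ, f τ := by
  set A : ℝ := ∫ τ in (0:ℝ)..ρ, f τ with hA
  -- each later value is at most `K/ρ · A`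
  have hpt : ∀ τ₂ ∈ Icc ρ θ, f τ₂ ≤ K / ρ * A := by
    intro τ₂ hτ₂
    have hle : ∀ τ₁ ∈ Icc 0 ρ, f τ₂ / K ≤ f τ₁ := by
      intro τ₁ hτ₁
      rw [div_le_iff₀ hK, mul_comm]
      exact hmono τ₁ τ₂ hτ₁.1 (hτ₁.2.trans hτ₂.1) hτ₂.2
    have hi : IntervalIntegrable f volume 0 ρ := (hf.mono (Icc_subset_Icc_right hρθ)).intervalIntegrable_of_Icc hρ.le
    have hconst : ∫ τ in (0:ℝ)..ρ, f τ₂ / K = ρ * (f τ₂ / K) := by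
      rw [intervalIntegral.integral_const, smul_eq_mul, sub_zero]
    have hmono_int : ∫ τ in (0:ℝ)..ρ, f τ₂ / K ≤ ∫ τ in (0:ℝ)..ρ, f τ :=
      intervalIntegral.integral_mono_on hρ.le intervalIntegrable_const hi fun τ hτ => hle τ hτ
    rw [hconst] at hmono_int
    rw [div_mul_eq_mul_div, le_div_iff₀ hρ]
    have : ρ * (f τ₂ / K) * K ≤ A * K := mul_le_mul_of_nonneg_right hmono_int hK.le
    calc f τ₂ * ρ = ρ * (f τ₂ / K) * K := by field_simp
      _ ≤ A * K := this
      _ = K * A := mul_comm _ _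
  have hi2 : IntervalIntegrable f volume ρ θ := (hf.mono (Icc_subset_Icc_left hρ.le)).intervalIntegrable_of_Icc hρθ
  calc ∫ τ in ρ..θ, f τ ≤ ∫ τ in ρ..θ, K / ρ * A :=
        intervalIntegral.integral_mono_on hρθ hi2 intervalIntegrable_const fun τ hτ => hpt τ hτ
    _ = (θ - ρ) * (K / ρ * A) := by rw [intervalIntegral.integral_const, smul_eq_mul]
    _ = K * ((θ - ρ) / ρ) * A := by field_simp

/-- **Loss-rate monotonicity at the Galerkin level** ((N2) for the approximations; tenure D26-17′). Along a solution
on `[0, T]` staying in the Galerkin phase space (`NearIso 𝔸 lo hi`, `0 < lo`, smooth carrier `SmoothCarrier b M G`),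
for `0 < ρ ≤ θ ≤ T`:
`E(ρ) − E(θ) ≤ ((|hi|/lo)·exp(2·(card d)·G·θ)) · ((θ − ρ)/ρ) · (E(0) − E(ρ))`
— the energy lost on `[ρ, θ]` is at most `Cmono · (θ−ρ)/ρ` times the energy lost on `[0, ρ]`.
[cite: RobinsonRodrigoSadowski2016, §6.1] -/
theorem pvsEnergy_loss_later_le {𝔸 : Visc4 d} {lo hi : ℝ} (h𝔸 : NearIso 𝔸 lo hi) (hlo : 0 < lo)
    (hS : ∀ k ∈ S, -k ∈ S) {b : ℝ → UnitAddTorus d → EuclideanSpace ℝ d} {M G : ℝ} (hb : SmoothCarrier b M G)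
    {T : ℝ} {α : ℝ → ↥S → EuclideanSpace ℂ d}
    (hα : ∀ t ∈ Icc 0 T, HasDerivWithinAt α (pvsRHS S 𝔸 (b t) (α t)) (Icc 0 T) t)
    (hmem : ∀ t ∈ Icc 0 T, α t ∈ galerkinSubspace S) (hcont : ContinuousOn α (Icc 0 T))
    {ρ θ : ℝ} (hρ : 0 < ρ) (hρθ : ρ ≤ θ) (hθT : θ ≤ T) :
    pvsEnergy S (α ρ) - pvsEnergy S (α θ) ≤
      (|hi| / lo * Real.exp (2 * ((Fintype.card d : ℝ) * G) * θ)) * ((θ - ρ) / ρ) *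
        (pvsEnergy S (α 0) - pvsEnergy S (α ρ)) := by
  set K : ℝ := |hi| / lo * Real.exp (2 * ((Fintype.card d : ℝ) * G) * θ) with hK
  -- the energy losses are time integrals of the rate
  have hE1 := pvsEnergy_eq_sub_integral 𝔸 hS hb.smooth hb.divFree hα hmem hcont le_rfl hρ.le (hρθ.trans hθT)
  have hE2 := pvsEnergy_eq_sub_integral 𝔸 hS hb.smooth hb.divFree hα hmem hcont hρ.le hρθ hθT
  have eL : pvsEnergy S (α ρ) - pvsEnergy S (α θ) = 2 * ∫ τ in ρ..θ, pvsDiss S 𝔸 (α τ) := by linarith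
  have eR : pvsEnergy S (α 0) - pvsEnergy S (α ρ) = 2 * ∫ τ in (0:ℝ)..ρ, pvsDiss S 𝔸 (α τ) := by linarith
  rw [eL, eR]
  -- `lo > 0` forces `hi ≠ 0` unless `S` carries no enstrophy; treat `K = 0` separately
  by_cases hK0 : K ≤ 0
  · -- then `|hi| = 0`, so the rate vanishes identically on transversal states
    have hhi : |hi| = 0 := by
      have hKnn : 0 ≤ K := by rw [hK]; positivity
      have hK00 : K = 0 := le_antisymm hK0 hKnn
      have hexp : 0 < Real.exp (2 * ((Fintype.card d : ℝ) * G) * θ) := Real.exp_pos _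
      rw [hK] at hK00
      rcases mul_eq_zero.1 hK00 with h | h
      · rw [div_eq_zero_iff] at h
        rcases h with h | h
        · exact h
        · exact absurd h hlo.ne'
      · exact absurd h hexp.ne'
    have hD0 : ∀ τ ∈ Icc 0 T, pvsDiss S 𝔸 (α τ) = 0 := by
      intro τ hτ
      have hup := pvsDiss_le_abs_hi_mul_pvsEnstrophy h𝔸 (hmem τ hτ).2
      rw [hhi, zero_mul] at hup
      exact le_antisymm hup (pvsDiss_nonneg h𝔸 hlo.le (hmem τ hτ).2)
    have hI1 : ∫ τ in ρ..θ, pvsDiss S 𝔸 (α τ) = 0 := by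
      rw [intervalIntegral.integral_of_le hρθ]
      refine setIntegral_eq_zero_of_forall_eq_zero fun τ hτ => hD0 τ ⟨hρ.le.trans hτ.1.le, hτ.2.trans hθT⟩
    have hI2 : ∫ τ in (0:ℝ)..ρ, pvsDiss S 𝔸 (α τ) = 0 := by
      rw [intervalIntegral.integral_of_le hρ.le]
      refine setIntegral_eq_zero_of_forall_eq_zero fun τ hτ => hD0 τ ⟨hτ.1.le, hτ.2.trans (hρθ.trans hθT)⟩
    rw [hI1, hI2]; simp
  · push Not at hK0
    have hDcont : ContinuousOn (fun τ => pvsDiss S 𝔸 (α τ)) (Icc 0 θ) :=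
      (continuousOn_pvsDiss_comp 𝔸 hcont).mono (Icc_subset_Icc_right hθT)
    have hmono : ∀ τ₁ τ₂, 0 ≤ τ₁ → τ₁ ≤ τ₂ → τ₂ ≤ θ → pvsDiss S 𝔸 (α τ₂) ≤ K * pvsDiss S 𝔸 (α τ₁) := by
      intro τ₁ τ₂ h1 h12 h2
      refine (pvsDiss_le_mul_pvsDiss h𝔸 hlo hS hb hα hmem h1 h12 (h2.trans hθT)).trans ?_
      refine mul_le_mul_of_nonneg_right ?_ (pvsDiss_nonneg h𝔸 hlo.le (hmem τ₁ ⟨h1, h12.trans (h2.trans hθT)⟩).2)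
      refine mul_le_mul_of_nonneg_left (Real.exp_le_exp.2 ?_) (by positivity)
      have hG := hb.grad_nonneg
      have hsub' : τ₂ - τ₁ ≤ θ := by linarith
      exact mul_le_mul_of_nonneg_left hsub' (by positivity)
    have h := integral_later_le_of_quasiMonotone' hK0 hρ hρθ hDcont hmono
    have h2 := mul_le_mul_of_nonneg_left h (by norm_num : (0:ℝ) ≤ 2)
    linarith [h2]

end Literature.Analysis.FluidPDE
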